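import Summits.HodgeConjecture.HodgeConjecture.Theorems.MarkmanPartnerTransportK3Sq2KugaSatakeMixedTransport
import Summits.HodgeConjecture.HodgeConjecture.Theorems.MarkmanPartnerTransportKugaSatakeSimilitudeVarescoFree
import Summits.HodgeConjecture.HodgeConjecture.Theses.MarkmanPartnerTransport

/-!
# Route MarkmanPartnerTransport · support #2 `PartnerTransport` (stmt-HodgeConjecture-19650) BY NAME, GRANTED
# KUGA–SATAKE (programme «KS-MIXED», step M5, closing file)

`partnerTransport_of_kugaSatake`: the route declaration
`Summit.HodgeConjecture.HodgeConjecture.Theses.MarkmanPartnerTransport.PartnerTransport` (for a marked smooth projective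
`K3^{[2]}`-type `X`, a marked projective K3 surface `S` and a transcendental Hodge isometry `g : H²(S) → H²(X)` with
(g1)–(g7): `HC⁴(S ⊗ S) → HC⁴(X)`) follows from

* the Kuga–Satake Hodge conjecture for projective K3 surfaces (`IsKSCorrespondenceAlgebraicBetti`, HYPOTHESIS `hKS`) and
  for smooth projective `K3^{[2]}`-type fourfolds (`IsKSCorrespondenceAlgebraicHK 2`, HYPOTHESIS `hKSX`) — both OPEN
  in print —, and
* the records `VerbitskyGuan_cohomology_K3HilbertSquareType`, `OGrady2008_dualBBFClass_algebraic`,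
  `CharlesMarkman2013_lefschetzStandard_K3HilbertType`,

through `KugaSatakeMixed.hodgeConjectureFor_of_square_of_kugaSatake_SX` (Varesco's mixed Cor. 4.6 + a Schur / subfield
argument), i.e. WITHOUT Markman's 2024 isometry theorem, Beauville's incidence/double-cover records and Voisin's
cup-product record used by `PartnerLattice.partnerTransport_of_facts`. Only the clauses (g1), (g2), (g4), (g5), (g6)
of the partner datum are used; injectivity of `g` on `T(S)_ℂ` is derived from (g5)
(`eq_zero_of_transc_of_isometry_zero`). This is a SECOND, independent conditional proof of the support item; it does
not close it (the item's own signature is what the gate checks) and credits nothing to the Hodge conjecture.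

THEOREMS ONLY; no sorry, no definition, no new named fact. Prover seat hodge-nonav-19652-p1 (gen 16),
`--supports stmt-HodgeConjecture-19650`.

References: M. Varesco, Math. Z. 305 (2023) Cor. 4.6, Rem. 5.5, §2; F. Charles, E. Markman, Compos. Math. 149 (2013)
Thm. 1.1; M. Verbitsky, GAFA 6 (1996); K. O'Grady, Commun. Contemp. Math. 10 (2008) §3; B. van Geemen (2000) §10.
-/

set_option linter.dupNamespace false

noncomputable section

namespace Summit.HodgeConjecture.HodgeConjecture.Theorems.MarkmanPartnerTransport.KugaSatakeMixed

open CategoryTheory MonoidalCategory Literature.AlgebraicGeometry Literature.AlgebraicGeometry.Motives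
open Literature.AlgebraicGeometry.HodgeTheory Literature.AlgebraicTopology.SingularHomology
open Literature.AlgebraicGeometry.Hyperkaehler Literature.AlgebraicGeometry.Surfaces
open Summit.HodgeConjecture.HodgeConjecture.Theorems.NikulinTwinTransport
open Summit.HodgeConjecture.HodgeConjecture.Theorems.MarkmanPartnerTransport.KugaSatakeSimilitude

/-- **`PartnerTransport` (route MarkmanPartnerTransport, support #2, stmt-HodgeConjecture-19650) GRANTED the
Kuga–Satake Hodge conjecture for projective K3 surfaces and for smooth projective `K3^{[2]}`-type fourfolds**, modulo
the records {Verbitsky–Guan, O'Grady 2008, Charles–Markman 2013} — the route declaration itself, by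
`hodgeConjectureFor_of_square_of_kugaSatake_SX` at `μ = (∫_S p)⁻¹` (clause (g5) read through the marking
`a ∪ b = (ηa·ηb) p`). CONDITIONAL on the two Kuga–Satake hypotheses (OPEN in print); a second proof route of the
support item, independent of Markman 2024 / Beauville 1983. [cite: Varesco2023, Cor. 4.6 and §2 (p. 8)]
[cite: CharlesMarkman2013, Thm. 1.1 (§1)] [cite: vanGeemen2000KugaSatakeHC, §10.2] -/
theorem partnerTransport_of_kugaSatake
    (hV : VerbitskyGuan_cohomology_K3HilbertSquareType) (hO : OGrady2008_dualBBFClass_algebraic)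
    (hCM : CharlesMarkman2013_lefschetzStandard_K3HilbertType)
    (hKS : ∀ (S : SchemeOver ℂ) (hS : IsK3Surface S), IsKSCorrespondenceAlgebraicBetti (IsK3Surface.isSmoothProjective hS))
    (hKSX : ∀ (X : SchemeOver ℂ) (hX : IsSmoothProjective 4 X), IsOfK3HilbertSquareType X →
      IsKSCorrespondenceAlgebraicHK 2 hX) :
    Summit.HodgeConjecture.HodgeConjecture.Theses.MarkmanPartnerTransport.PartnerTransport := by
  intro X hX hK φ P z hM S hS η p x hMS g hg hHC
  have hσ0 := marking_symm_ne_zero hMS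
  obtain ⟨hp0, hmk, -, -, -⟩ := hMS
  obtain ⟨hg1, hg2, -, hg4, hg5, hg6, -⟩ := hg
  have hS2 : IsSmoothProjective 2 S := IsK3Surface.isSmoothProjective hS
  have hcupS := hmk.2.2.2.1
  have h20 := hmk.2.2.2.2.1
  have hline := hmk.2.2.2.2.2
  have hτ : traceC hS2 p ≠ 0 := fun h0 => hp0 (eq_zero_of_traceC_eq_zero hS2 h0)
  -- clause (g5) as a multiplier: `q(φ g y, φ g w) = (∫ p)⁻¹ ∫ y ∪ w` on `T(S)_ℂ`
  have hmul : ∀ y w : complexBetti S (2 * 1),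
      (∀ d ∈ algebraicClasses S 1, cupProduct (rfl : 2 * 1 + 2 * 1 = 2 * 2) y d = 0) →
      (∀ d ∈ algebraicClasses S 1, cupProduct (rfl : 2 * 1 + 2 * 1 = 2 * 2) w d = 0) →
      k3HilbertForm 2 (φ (g y)) (φ (g w)) =
        (traceC hS2 p)⁻¹ * traceC hS2 (cupProduct (rfl : 2 * 1 + 2 * 1 = 2 * 2) y w) := by
    intro y w hy hw
    rw [hg5 y w hy hw, hcupS y w, map_smul, smul_eq_mul, mul_comm (k3Form (η y) (η w)), ← mul_assoc,
      inv_mul_cancel₀ hτ, one_mul]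
  have hinj : ∀ y : complexBetti S (2 * 1),
      (∀ d ∈ algebraicClasses S 1, cupProduct (rfl : 2 * 1 + 2 * 1 = 2 * 2) y d = 0) → g y = 0 → y = 0 :=
    fun y hy h0 => eq_zero_of_transc_of_isometry_zero hS2 h20 hσ0 hline g (inv_ne_zero hτ) hmul hy h0
  exact hodgeConjectureFor_of_square_of_kugaSatake_SX hV hO hCM hS2 h20 hσ0 hline hX hK hM (hKS S hS) (hKSX X hX hK)
    g hg1 hg2 hg4 hinj hg6 (inv_ne_zero hτ) hmul hHC

end Summit.HodgeConjecture.HodgeConjecture.Theorems.MarkmanPartnerTransport.KugaSatakeMixed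

end
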